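import Summits.AtomisticToContinuum.HydrodynamicLimit.Theorems.AntiMazurCoboundariesKineticWindowGronwallPlusNode
import Literature.MathematicalPhysics.KineticTheory.HardSphereEulerProofs
import Literature.MathematicalPhysics.KineticTheory.HardSphereDisplacementPathLength
import Literature.MathematicalPhysics.KineticTheory.CollisionWindowBookkeeping
import Literature.Analysis.FluidPDE.CollisionalTransfer
import HarnessLib

/-!
# Toolkit statements toward stub 1, content (iii) (window clause under a NON-invariant local reference) — lead c6, line `board-node-dock`, crux 9282

Registered helper stubs (ride with `--supports stmt-AtomisticToContinuum-9282`): `stub_renyiHolderTransfer : RenyiHolderTransfer` (worker),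
`stub_densityOnlyWindowRenyi : DensityOnlyWindowRenyi` (lead), `stub_windowClauseOfRenyi : WindowClauseOfRenyi` (worker). Composition (to be
kernel-checked at integration): for DENSITY-ONLY local Gibbs data the node`s window clause `∃τ₀ ∀τ ≥ τ₀` follows from the bound on one band of
windows (Rényi quasi-invariance is a theorem there: energy + momentum conservation freeze the Maxwellian factor); for general data the Rényi
hypothesis of `WindowClauseOfRenyi` is the open dynamic input (collision traffic of kinetic energy between positions at different temperature).
-/

noncomputable section

namespace Summit.AtomisticToContinuum.HydrodynamicLimit.Theorems.KineticWindowGronwallWindowRenyi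

open _root_.MeasureTheory _root_.Set _root_.Filter
open scoped _root_.ENNReal
open Literature.Analysis.FluidPDE Literature.MathematicalPhysics.KineticTheory

/-- The hard-sphere flow of `N+1` spheres at reduced density `σ` on `𝕋³`. -/
abbrev TFlow (σ : ℝ) (N : ℕ) : Type :=
  HardSphereFlow (Torus.geometry (Fin 3)) (hsDiameter σ N) (N + 1)

/-- The Liouville measure of `N+1` spheres at reduced density `σ` on `𝕋³`. -/
abbrev liou (σ : ℝ) (N : ℕ) : Measure (Config (N + 1) (Fin 3) T3) :=
  liouville (Torus.geometry (Fin 3)) (N + 1) (hsDiameter σ N)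

/-- The local Gibbs DENSITY with respect to the Liouville measure (the canonical density of the local Gibbs profile,
as an extended nonnegative real): `localGibbsLaw σ a u₀ θ₀ N Φ = (liou σ N).withDensity (lgDensity σ a θ₀ u₀ N)`. -/
def lgDensity (σ : ℝ) (a θ₀ : T3 → ℝ) (u₀ : T3 → V3) (N : ℕ) (z : Config (N + 1) (Fin 3) T3) : ℝ≥0∞ :=
  ENNReal.ofReal (canonicalDensity (Torus.geometry (Fin 3)) (hsDiameter σ N) (N + 1) (localGibbsProfile a u₀ θ₀) z)

/-- Sanity: the local Gibbs law is the Liouville measure with density `lgDensity`. -/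
example (σ : ℝ) (a θ₀ : T3 → ℝ) (u₀ : T3 → V3) (N : ℕ) (Φ : TFlow σ N) :
    localGibbsLaw σ a u₀ θ₀ N Φ = (liou σ N).withDensity (lgDensity σ a θ₀ u₀ N) := rfl

/-- **Helper statement `RenyiHolderTransfer`**: Hölder transfer of an observable along a Liouville-preserving hard-sphere
flow, paid by the order-`p` Rényi integral of the transported density. For a measurable density `ψ` w.r.t. the Liouville
measure, Liouville-a.e. nonzero and never `∞`, every measurable `H ≥ 0`, time `s` and conjugate exponents `p, q`:
`∫ H(Φ_s z) (ψL)(dz) ≤ (∫ (ψ(Φ_{-s} z)/ψ(z))^p (ψL)(dz))^{1/p} · (∫ H^q d(ψL))^{1/q}`. -/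
def RenyiHolderTransfer : Prop :=
  ∀ (σ : ℝ) (N : ℕ) (Φ : TFlow σ N) (ψ : Config (N + 1) (Fin 3) T3 → ℝ≥0∞), Measurable ψ →
    (∀ᵐ z ∂(liou σ N), ψ z ≠ 0) → (∀ z, ψ z ≠ ∞) →
    ∀ (H : Config (N + 1) (Fin 3) T3 → ℝ≥0∞), Measurable H →
    ∀ (s p q : ℝ), p.HolderConjugate q →
      ∫⁻ z, H (Φ.flow s z) ∂((liou σ N).withDensity ψ) ≤
        (∫⁻ z, (ψ (Φ.flow (-s) z) / ψ z) ^ p ∂((liou σ N).withDensity ψ)) ^ (1 / p) *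
          (∫⁻ z, H z ^ q ∂((liou σ N).withDensity ψ)) ^ (1 / q)

/-- **Helper statement `DensityOnlyWindowRenyi`**: order-`p` Rényi quasi-invariance of DENSITY-ONLY local Gibbs laws
(constant temperature `θc`, constant drift `uc`, continuous activity `a > 0`) over kinetic windows: for every `p ≥ 1`,
`τ > 0`, `ε > 0`, eventually in `N`, for every flow and every shift `|s| ≤ τ(N+1)^{-1/3}`,
`∫ (ψ_N(Φ_{-s} z)/ψ_N(z))^p λ_N(dz) ≤ e^{ε(N+1)}` — energy and momentum conservation freeze the Maxwellian factor, the
activity factor moves by the path length, which is `≤ s((N+1)/2 + E)`. -/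
def DensityOnlyWindowRenyi : Prop :=
  ∀ (θc : ℝ), 0 < θc → ∀ (uc : V3) (a : T3 → ℝ), Continuous a → (∀ x, 0 < a x) →
    ∀ (σ p : ℝ), 1 ≤ p → ∀ (τ ε : ℝ), 0 < τ → 0 < ε →
    ∃ N₀ : ℕ, ∀ N : ℕ, N₀ ≤ N → ∀ (Φ : TFlow σ N) (s : ℝ), |s| ≤ τ * ((N : ℝ) + 1) ^ (-(1 / 3 : ℝ)) →
      ∫⁻ z, (lgDensity σ a (fun _ => θc) (fun _ => uc) N (Φ.flow (-s) z) /
              lgDensity σ a (fun _ => θc) (fun _ => uc) N z) ^ p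
          ∂(localGibbsLaw σ a (fun _ => uc) (fun _ => θc) N Φ) ≤
        ENNReal.ofReal (Real.exp (ε * ((N : ℝ) + 1)))

/-- The window exponential moment of the node, at window parameter `τ`, tilt `β`, one-body functional `F`. -/
def windowMoment (σ : ℝ) (a θ₀ : T3 → ℝ) (u₀ : T3 → V3) (Φ : (N : ℕ) → TFlow σ N) (F : T3 × V3 → ℝ)
    (N : ℕ) (τ β : ℝ) : ℝ≥0∞ :=
  ∫⁻ z, ENNReal.ofReal (Real.exp (β * ∑ i : Fin (N + 1),
      (τ * ((N : ℝ) + 1) ^ (-(1 / 3 : ℝ)))⁻¹ *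
        ∫ r in (0 : ℝ)..(τ * ((N : ℝ) + 1) ^ (-(1 / 3 : ℝ))), F (((Φ N).flow r z) i)))
    ∂(localGibbsLaw σ a u₀ θ₀ N (Φ N))

/-- **Helper statement `WindowClauseOfRenyi`** (pointwise in the datum; continuous data with `a, θ₀ > 0`, so that the local Gibbs
density is Liouville-a.e. positive and the Rényi integral below is the true order-`p` Rényi divergence): IF the local Gibbs laws of
a datum are order-`p` Rényi quasi-invariant over kinetic windows along the flow family, THEN the window bound on ONE band of windows
`τ ∈ [τ₀, 2τ₀]` at tilt radius `b` upgrades to ALL windows `τ ≥ τ₀` at tilt radius `b/q` (`q` conjugate to `p`):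
split `[0, kw]` into `k` shifted sub-windows, generalised Hölder with `k` factors, transfer each shifted factor back to
time `0` by `RenyiHolderTransfer`. -/
def WindowClauseOfRenyi : Prop :=
  ∀ (σ : ℝ) (a θ₀ : T3 → ℝ) (u₀ : T3 → V3), Continuous a → Continuous θ₀ → Continuous u₀ →
    (∀ x, 0 < a x) → (∀ x, 0 < θ₀ x) →
    ∀ (Φ : (N : ℕ) → TFlow σ N) (F : T3 × V3 → ℝ), Continuous F →
    ∀ (p q : ℝ), p.HolderConjugate q →
    (∀ τ ε : ℝ, 0 < τ → 0 < ε → ∃ N₀ : ℕ, ∀ N : ℕ, N₀ ≤ N → ∀ s : ℝ, 0 ≤ s →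
        s ≤ τ * ((N : ℝ) + 1) ^ (-(1 / 3 : ℝ)) →
        ∫⁻ z, (lgDensity σ a θ₀ u₀ N ((Φ N).flow (-s) z) / lgDensity σ a θ₀ u₀ N z) ^ p
            ∂(localGibbsLaw σ a u₀ θ₀ N (Φ N)) ≤ ENNReal.ofReal (Real.exp (ε * ((N : ℝ) + 1)))) →
    ∀ (b τ₀ : ℝ), 0 < τ₀ →
    (∀ β : ℝ, |β| ≤ b → ∀ ε : ℝ, 0 < ε → ∀ τ ∈ Icc τ₀ (2 * τ₀), ∃ N₀ : ℕ, ∀ N : ℕ, N₀ ≤ N →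
        windowMoment σ a θ₀ u₀ Φ F N τ β ≤ ENNReal.ofReal (Real.exp (ε * ((N : ℝ) + 1)))) →
    ∀ β : ℝ, |β| ≤ b / q → ∀ ε : ℝ, 0 < ε → ∀ τ : ℝ, τ₀ ≤ τ → ∃ N₀ : ℕ, ∀ N : ℕ, N₀ ≤ N →
        windowMoment σ a θ₀ u₀ Φ F N τ β ≤ ENNReal.ofReal (Real.exp (ε * ((N : ℝ) + 1)))

/-- **Helper statement `WindowRenyiOfIncrementTightness`** (GENERAL data; the open dynamic input of content (iii) made explicit):
for continuous data `(a, θ₀, u₀)` with `a, θ₀ > 0`, a flow family and an order `p > 1`, IF the kinetic-window INCREMENTS of the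
`θ₀⁻¹`-weighted kinetic energy `Σᵢ ‖vᵢ‖²/(2θ₀(xᵢ))` (`energyObservable θ₀⁻¹`) and of the `u₀/θ₀`-tested momentum
`Σᵢ ⟨u₀(xᵢ)/θ₀(xᵢ), vᵢ⟩` (`momentumObservable (θ₀⁻¹ • u₀)`) along the flow have exponential moments `≤ e^{ε(N+1)}` at parameter
`3(p−1)`, eventually in `N`, uniformly over shifts `0 ≤ s ≤ τ(N+1)^{-1/3}`, THEN the order-`p` Rényi quasi-invariance (R) of the local
Gibbs laws holds in exactly the form consumed by `WindowClauseOfRenyi` (the activity / log-partition part moves by the path length, as in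
`DensityOnlyWindowRenyi`; Liouville invariance turns the Rényi integral into the forward expectation `E_λ[(ψ/ψ∘Φ_s)^{p−1}]`; Hölder). -/
def WindowRenyiOfIncrementTightness : Prop :=
  ∀ (σ : ℝ) (a θ₀ : T3 → ℝ) (u₀ : T3 → V3), Continuous a → Continuous θ₀ → Continuous u₀ →
    (∀ x, 0 < a x) → (∀ x, 0 < θ₀ x) →
    ∀ (Φ : (N : ℕ) → TFlow σ N) (p : ℝ), 1 < p →
    (∀ τ ε : ℝ, 0 < τ → 0 < ε → ∃ N₀ : ℕ, ∀ N : ℕ, N₀ ≤ N → ∀ s : ℝ, 0 ≤ s →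
        s ≤ τ * ((N : ℝ) + 1) ^ (-(1 / 3 : ℝ)) →
        ∫⁻ z, ENNReal.ofReal (Real.exp (3 * (p - 1) *
            |energyObservable (fun x => (θ₀ x)⁻¹) ((Φ N).flow s z) - energyObservable (fun x => (θ₀ x)⁻¹) z|))
          ∂(localGibbsLaw σ a u₀ θ₀ N (Φ N)) ≤ ENNReal.ofReal (Real.exp (ε * ((N : ℝ) + 1)))) →
    (∀ τ ε : ℝ, 0 < τ → 0 < ε → ∃ N₀ : ℕ, ∀ N : ℕ, N₀ ≤ N → ∀ s : ℝ, 0 ≤ s →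
        s ≤ τ * ((N : ℝ) + 1) ^ (-(1 / 3 : ℝ)) →
        ∫⁻ z, ENNReal.ofReal (Real.exp (3 * (p - 1) *
            |momentumObservable (fun x => (θ₀ x)⁻¹ • u₀ x) ((Φ N).flow s z) -
              momentumObservable (fun x => (θ₀ x)⁻¹ • u₀ x) z|))
          ∂(localGibbsLaw σ a u₀ θ₀ N (Φ N)) ≤ ENNReal.ofReal (Real.exp (ε * ((N : ℝ) + 1)))) →
    ∀ τ ε : ℝ, 0 < τ → 0 < ε → ∃ N₀ : ℕ, ∀ N : ℕ, N₀ ≤ N → ∀ s : ℝ, 0 ≤ s →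
        s ≤ τ * ((N : ℝ) + 1) ^ (-(1 / 3 : ℝ)) →
        ∫⁻ z, (lgDensity σ a θ₀ u₀ N ((Φ N).flow (-s) z) / lgDensity σ a θ₀ u₀ N z) ^ p
            ∂(localGibbsLaw σ a u₀ θ₀ N (Φ N)) ≤ ENNReal.ofReal (Real.exp (ε * ((N : ℝ) + 1)))

/-- **Helper statement `EnergyIncrementOfFrozenTransfer`** (STATICS inside H_E): for continuous data with `a, θ₀ > 0` and a flow family
there is `c₀ > 0` (depending on the temperature range only) such that for every `0 < c ≤ c₀`: IF the FROZEN-COEFFICIENT collisional transfer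
`T(z, s) := Σᵢ (θ₀(xᵢ(s)))⁻¹ (‖vᵢ(s)‖² − ‖vᵢ(0)‖²)/2` (coefficients read at the END of the window; a sum over collisions of the exchanged
energy times the coefficient difference of the two partners, bounded by energies — blind to collision counts) has exponential moments
`≤ e^{ε(N+1)}` at parameter `2c`, eventually in `N`, uniformly over `0 ≤ s ≤ τ(N+1)^{-1/3}`, THEN so do the full increments of the weighted
kinetic energy `energyObservable θ₀⁻¹` at parameter `c` (hypothesis H_E of `WindowRenyiOfIncrementTightness`): the displacement part
`Σᵢ ((θ₀(xᵢ(s)))⁻¹ − (θ₀(xᵢ(0)))⁻¹)‖vᵢ(0)‖²/2` is exponentially negligible STATICALLY (affine modulus `δ + K·dist`; at most `(L/δ')·s((N+1)/2+E)`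
particles move farther than `δ'/K`; Gaussian high-energy content under the time-0 fibres). -/
def EnergyIncrementOfFrozenTransfer : Prop :=
  ∀ (σ : ℝ) (a θ₀ : T3 → ℝ) (u₀ : T3 → V3), Continuous a → Continuous θ₀ → Continuous u₀ →
    (∀ x, 0 < a x) → (∀ x, 0 < θ₀ x) → ∀ (Φ : (N : ℕ) → TFlow σ N),
    ∃ c₀ : ℝ, 0 < c₀ ∧ ∀ c : ℝ, 0 < c → c ≤ c₀ →
    (∀ τ ε : ℝ, 0 < τ → 0 < ε → ∃ N₀ : ℕ, ∀ N : ℕ, N₀ ≤ N → ∀ s : ℝ, 0 ≤ s →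
        s ≤ τ * ((N : ℝ) + 1) ^ (-(1 / 3 : ℝ)) →
        ∫⁻ z, ENNReal.ofReal (Real.exp (2 * c *
            |∑ i : Fin (N + 1), (θ₀ ((Φ N).flow s z i).1)⁻¹ * ((‖((Φ N).flow s z i).2‖ ^ 2 - ‖(z i).2‖ ^ 2) / 2)|))
          ∂(localGibbsLaw σ a u₀ θ₀ N (Φ N)) ≤ ENNReal.ofReal (Real.exp (ε * ((N : ℝ) + 1)))) →
    ∀ τ ε : ℝ, 0 < τ → 0 < ε → ∃ N₀ : ℕ, ∀ N : ℕ, N₀ ≤ N → ∀ s : ℝ, 0 ≤ s →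
        s ≤ τ * ((N : ℝ) + 1) ^ (-(1 / 3 : ℝ)) →
        ∫⁻ z, ENNReal.ofReal (Real.exp (c *
            |energyObservable (fun x => (θ₀ x)⁻¹) ((Φ N).flow s z) - energyObservable (fun x => (θ₀ x)⁻¹) z|))
          ∂(localGibbsLaw σ a u₀ θ₀ N (Φ N)) ≤ ENNReal.ofReal (Real.exp (ε * ((N : ℝ) + 1)))

/-- **Helper statement `MomentumIncrementOfFrozenTransfer`** (STATICS inside H_M; momentum twin of `EnergyIncrementOfFrozenTransfer`):
for continuous data with `a, θ₀ > 0` and a flow family, for EVERY `c > 0`: IF the frozen-coefficient collisional momentum transfer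
`Σᵢ ⟨u₀(xᵢ(s))/θ₀(xᵢ(s)), vᵢ(s) − vᵢ(0)⟩` has exponential moments `≤ e^{ε(N+1)}` at parameter `2c`, eventually, uniformly over
`0 ≤ s ≤ τ(N+1)^{-1/3}`, THEN so do the increments of `momentumObservable (θ₀⁻¹ • u₀)` at parameter `c` (hypothesis H_M of
`WindowRenyiOfIncrementTightness`): the displacement part `Σᵢ ⟨J(xᵢ(s)) − J(xᵢ(0)), vᵢ(0)⟩`, `J = u₀/θ₀`, is LINEAR in the time-0 velocities and
exponentially negligible statically (no smallness condition on `c`). -/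
def MomentumIncrementOfFrozenTransfer : Prop :=
  ∀ (σ : ℝ) (a θ₀ : T3 → ℝ) (u₀ : T3 → V3), Continuous a → Continuous θ₀ → Continuous u₀ →
    (∀ x, 0 < a x) → (∀ x, 0 < θ₀ x) → ∀ (Φ : (N : ℕ) → TFlow σ N) (c : ℝ), 0 < c →
    (∀ τ ε : ℝ, 0 < τ → 0 < ε → ∃ N₀ : ℕ, ∀ N : ℕ, N₀ ≤ N → ∀ s : ℝ, 0 ≤ s →
        s ≤ τ * ((N : ℝ) + 1) ^ (-(1 / 3 : ℝ)) →
        ∫⁻ z, ENNReal.ofReal (Real.exp (2 * c *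
            |∑ i : Fin (N + 1), inner ℝ ((θ₀ ((Φ N).flow s z i).1)⁻¹ • u₀ ((Φ N).flow s z i).1)
              (((Φ N).flow s z i).2 - (z i).2)|))
          ∂(localGibbsLaw σ a u₀ θ₀ N (Φ N)) ≤ ENNReal.ofReal (Real.exp (ε * ((N : ℝ) + 1)))) →
    ∀ τ ε : ℝ, 0 < τ → 0 < ε → ∃ N₀ : ℕ, ∀ N : ℕ, N₀ ≤ N → ∀ s : ℝ, 0 ≤ s →
        s ≤ τ * ((N : ℝ) + 1) ^ (-(1 / 3 : ℝ)) →
        ∫⁻ z, ENNReal.ofReal (Real.exp (c *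
            |momentumObservable (fun x => (θ₀ x)⁻¹ • u₀ x) ((Φ N).flow s z) -
              momentumObservable (fun x => (θ₀ x)⁻¹ • u₀ x) z|))
          ∂(localGibbsLaw σ a u₀ θ₀ N (Φ N)) ≤ ENNReal.ofReal (Real.exp (ε * ((N : ℝ) + 1)))

/-- **Helper statement `BackwardTiltEnergyIncrementFree`** (the FREE half of H_E, drift-free data): for continuous `a, θ₀ > 0`, `u₀ ≡ 0`,
a flow family and every tilt `c ∈ [0, 1]`, the NEGATIVE exponential moments `E_λ exp(−c·(E_κ(Φ_s z) − E_κ(z)))`, `E_κ = energyObservable θ₀⁻¹`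
(`= Σᵢ ‖vᵢ‖²/(2θ₀(xᵢ))`, the velocity exponent of the local Gibbs density), are `≤ e^{ε(N+1)}` eventually in `N`, uniformly over
`0 ≤ s ≤ τ(N+1)^{-1/3}`: at `c = 1` Liouville invariance turns the integral into `E_λ exp(Σᵢ ℓ(xᵢ(−s)) − ℓ(xᵢ(0)))` with the POSITION-ONLY
`ℓ = log a − (3/2)log(2πθ₀)` (path length, as in `DensityOnlyWindowRenyi`), and `0 < c < 1` follows by Hölder interpolation with `c = 0`.
So anti-thermodynamic O(N) decreases of `E_κ` within a kinetic window are exponentially unlikely for free; the open core of (iii) is the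
ONE-SIDED positive tilt (excess forward collisional heat conduction). -/
def BackwardTiltEnergyIncrementFree : Prop :=
  ∀ (σ : ℝ) (a θ₀ : T3 → ℝ), Continuous a → Continuous θ₀ → (∀ x, 0 < a x) → (∀ x, 0 < θ₀ x) →
    ∀ (Φ : (N : ℕ) → TFlow σ N) (c : ℝ), 0 ≤ c → c ≤ 1 →
    ∀ τ ε : ℝ, 0 < τ → 0 < ε → ∃ N₀ : ℕ, ∀ N : ℕ, N₀ ≤ N → ∀ s : ℝ, 0 ≤ s →
      s ≤ τ * ((N : ℝ) + 1) ^ (-(1 / 3 : ℝ)) →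
      ∫⁻ z, ENNReal.ofReal (Real.exp (-(c *
          (energyObservable (fun x => (θ₀ x)⁻¹) ((Φ N).flow s z) - energyObservable (fun x => (θ₀ x)⁻¹) z))))
        ∂(localGibbsLaw σ a (fun _ => (0 : V3)) θ₀ N (Φ N)) ≤ ENNReal.ofReal (Real.exp (ε * ((N : ℝ) + 1)))

/-- The VELOCITY EXPONENT of the local Gibbs density: `Θ(z) = Σᵢ ‖vᵢ‖²/(2θ₀(xᵢ)) − Σᵢ ⟪u₀(xᵢ)/θ₀(xᵢ), vᵢ⟫`
(`= Σᵢ ‖vᵢ − u₀(xᵢ)‖²/(2θ₀(xᵢ))` minus a position-only term; `log ψ_N = −log Z + Σᵢ ℓ(xᵢ) − Θ`). -/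
def velExponent (θ₀ : T3 → ℝ) (u₀ : T3 → V3) {n : ℕ} (z : Config n (Fin 3) T3) : ℝ :=
  energyObservable (fun x => (θ₀ x)⁻¹) z - momentumObservable (fun x => (θ₀ x)⁻¹ • u₀ x) z

/-- **THE ONE-SIDED OPEN CORE OF CONTENT (iii): `PositiveTiltVelocityExponent`** (landed with its reduction `stub_renyiOfPositiveTilt :
PositiveTiltVelocityExponent → WindowRenyiLocalGibbs`, file `…KineticWindowGronwallRenyiOfPositiveTilt.lean`). A packing guard `η₁ > 0` such that
for every temperature range, drift bound and `σ > 0` there is ONE tilt `c > 0` such that for every continuous datum of the class and every flow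
family the POSITIVE exponential moment of the kinetic-window increment of `Θ` is `≤ e^{ε(N+1)}` eventually, uniformly over
`0 ≤ s ≤ τ(N+1)^{-1/3}`. Negative tilts `c ∈ [−1, 0]` are free (affinity / `BackwardTiltEnergyIncrementFree`); this positive tilt — excess
forward collisional conduction of the local-frame thermal energy within one kinetic window at LD scale — is exactly what is open. -/
def PositiveTiltVelocityExponent : Prop :=
  ∃ η₁ : ℝ, 0 < η₁ ∧ ∀ (θm θM U : ℝ), 0 < θm → θm ≤ θM → 0 ≤ U → ∀ σ : ℝ, 0 < σ →
    ∃ c : ℝ, 0 < c ∧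
    ∀ (a θ₀ : T3 → ℝ) (u₀ : T3 → V3), Continuous a → Continuous θ₀ → Continuous u₀ →
    (∀ x, 0 < a x) → (∀ x, θm ≤ θ₀ x) → (∀ x, θ₀ x ≤ θM) → (∀ x, ‖u₀ x‖ ≤ U) →
    σ ^ 3 * (⨆ x, a x) ≤ η₁ * ∫ x, a x →
    ∀ Φ : (N : ℕ) → TFlow σ N,
    ∀ τ ε : ℝ, 0 < τ → 0 < ε → ∃ N₀ : ℕ, ∀ N : ℕ, N₀ ≤ N → ∀ s : ℝ, 0 ≤ s →
      s ≤ τ * ((N : ℝ) + 1) ^ (-(1 / 3 : ℝ)) →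
      ∫⁻ z, ENNReal.ofReal (Real.exp (c * (velExponent θ₀ u₀ ((Φ N).flow s z) - velExponent θ₀ u₀ z)))
        ∂(localGibbsLaw σ a u₀ θ₀ N (Φ N)) ≤ ENNReal.ofReal (Real.exp (ε * ((N : ℝ) + 1)))

end Summit.AtomisticToContinuum.HydrodynamicLimit.Theorems.KineticWindowGronwallWindowRenyi

end
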